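import Summits.Ventures.HSemireg.Pad4TowerSeedB1Odd

/-!
# Anomaly lens (plan-lens-HodgeAV-anomaly g0) — «THE SURVIVOR IS CHIRAL AND ISOTROPIC»: the typed reading of the parity anomaly of the
# H₁-static census, LEMMA A′ (all heights) and its PROVED level-duality reduction

HONEST FRAMING. Sketch file of ONE crux idea on stmt-HodgeConjecture-18881 (`EightfoldBlochSeeds.BlochSeedDiscOne`, skeleton
`Cruxes/BlochSeedDiscOne/Lines/birth.lean` 814a6a70c14e831a, STUB R `stub_rung_pad4_seedAt`). Everything here is about the typed PAD-4 ∕ 𝔅(μ₄)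
static game (`RuleDMu4Closed`, `XPlusClosed`, `A2IMinusClosed`, `G1Closed`, `InDiamond h`) of `Summits/Ventures/HSemireg/Pad4Tower*.lean`.
`NoLowerFC h`, `ChiralSeed h`, `ChiralSeedAllHeights` are HYPOTHESIS-FORM DEFS (typed statements, NOT asserted, no axiom, no sorry); the
theorems are elementary consequences ∕ reductions. NOTHING HERE SAYS THAT HC ∕ HC_CM ∕ HC_AV ∕ H2 HOLDS OR FAILS; HC and HC_AV are NOT proved.

CENSUS ROWS READ (the anomaly): gs-eng-2 g53 third code kit j309715 (◇₈, H₁, G₁: «odd FC» UNSAT 51.7 s; «FC with ≥ 2 distinct letters»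
UNSAT 48.5 s; «diagonal FC off the unit letters» UNSAT 51.5 s; «any FC» SAT 52.5 s), kit j309861 PEEL (97 541 ∕ 97 660 orbit literals failed;
ALL N-level FC literals dead by round 13, `N[ℓ_u]⁴` in round 11 by A2I⁻; sole FC survivor `P[6I+ℓ_u]⁴`; all 2-literal FC-cone conflicts are
G₁-folds: 7 547 A2I⁻ + 227 X⁺), bc5-plan kit j305149 r1∕r3 (minus-A2I⁻ SAT with FC = the four `N[ℓ_u]⁴`; minus-X⁺ SAT = full support),
kit j298438 no-Ψ v19 (all four families + FC1, G₁, ◇₈: SAT, FC = one orbit `P[6I+ℓ_ζ]⁴` hung from `8I`), ◇₆ j309729 (no FC at all).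

CONTENT. §1 ISOTROPY ⇒ PARITY (proved): an `S₄`-fixed cell is diagonal; a diagonal cell has pattern `0000` or `1111`; on axis cells the
phase bit is the phase quadrant mod 2, so the parity weight is `Σ_f phaseK (mod 2)` — the `mod 2` shadow of the tree's G-orbit key
`Σ_f phaseK (mod 4)` (`Pad4TowerRuleDMu4Dual.GKeyRel`). §2 LEMMA A′ (typed, all even heights): `ChiralSeed h` — on a `G₁`-closed `H₁`-static
two-level support in ◇_h there is NO fully charged N-class and every fully charged P-class is the ceiling unit diagonal `[(h−2)I+ℓ_u]⁴`;
corollaries at `h = 8`: (T) `SeedB1OddDiamond8G1H1` and (S) `SeedB1Diamond8G1H1` (proved from `ChiralSeed 8`). §3 THE MIRROR FAMILY and the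
PROVED REDUCTION: `StaticH1Mirror h C := RuleDMu4Closed C ∧ XPlusClosed (C.dual h) ∧ A2IMinusClosed (C.dual h)` (the ι_h-conjugates of X⁺,
A2I⁻ — NOT the families `XMinusClosed`, `A2IPlusClosed` of record, which are ι₀-conjugates: `A2I⁺` partners run UP the own ray, the mirror's
run up the ANTIPODAL ray to the anti-node); `noUpperFC_of_noLowerFC`: `NoLowerFC h` ⇒ no FC P-class on `G₁`-closed mirror-static supports in ◇_h;
hence `fcFree_of_noLowerFC` and `wch_eWord_eq_zero_of_noLowerFC`: on supports static for `H₁` AND its mirror, NO FC class at all and `μ = 0` for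
every positive (A1) multiplicity vector — parity-free and sign-free. §4 probes (`decide`): the survivor, a mixed ceiling cell, and (§4c) the GUARD
# CHIRALITY of the typed `A2I` family at the survivor letter (`A2I⁺` of record ≠ the `8`-mirror of `A2I⁻`). No `instance`, no notation, 0 `sorry`.
-/

namespace Summit.Ventures.HSemireg.Pad4Tower

open Finset

namespace AnomalyLens

/-! ## §1 Isotropy ⇒ parity -/

/-- a DIAGONAL (fully isotropic) cell: all four factor points equal. Decidable. -/
abbrev IsDiag (Z : MCell) : Prop := ∀ f, Z f = Z 0

/-- an `S₄`-FIXED cell is diagonal (the converse is trivial): the isotropy grading's top stratum. -/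
theorem isDiag_of_perm_fixed {Z : MCell} (h : ∀ σ : Equiv.Perm (Fin 4), Z.perm σ = Z) : IsDiag Z := fun f => by
  have := congrFun (h (Equiv.swap 0 f)) 0
  simpa [MCell.perm, Equiv.swap_apply_left] using this

/-- the parity weight of a diagonal cell is `4 · kbit`, hence EVEN. -/
theorem pwt_pat_of_isDiag {Z : MCell} (h : IsDiag Z) : pwt Z.pat = 4 * kbit (Z 0) := by
  simp only [pwt, bitOf_pat, h 1, h 2, h 3]
  ring

/-- a pattern of weight `0` is `0000`, of weight `4` is `1111`. [`decide`] -/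
theorem pat_of_pwt_zero_or_four : ∀ κ : Fin 16, (pwt κ = 0 → κ = 0) ∧ (pwt κ = 4 → κ = 15) := by decide

/-- a diagonal cell has pattern `0000` or `1111`. -/
theorem pat_of_isDiag {Z : MCell} (h : IsDiag Z) : Z.pat = 0 ∨ Z.pat = 15 := by
  have hw := pwt_pat_of_isDiag h
  have hk := kbit_le_one (Z 0)
  rcases Nat.eq_zero_or_pos (kbit (Z 0)) with h0 | hpos
  · exact Or.inl ((pat_of_pwt_zero_or_four Z.pat).1 (by omega))
  · exact Or.inr ((pat_of_pwt_zero_or_four Z.pat).2 (by omega))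

/-- hence a diagonal cell is never of odd parity weight, and never of pattern `0011` or `0001`. -/
theorem not_oddPat_of_isDiag {Z : MCell} (h : IsDiag Z) : ¬ OddPat Z.pat ∧ Z.pat ≠ 3 ∧ Z.pat ≠ 1 := by
  rcases pat_of_isDiag h with hp | hp
  · rw [hp]; decide
  · rw [hp]; decide

/-- **PARITY IS THE SHADOW OF THE PHASE KEY**: on an axis letter the phase bit is the phase quadrant mod 2. -/
theorem kbit_eq_phaseK_mod_two (x : BPoint) (hx : AxisPt x) : kbit x = (phaseK x).val % 2 := by
  obtain ⟨a, b1, b2⟩ := x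
  simp only [AxisPt, ne_eq] at hx
  simp only [kbit, phaseK]
  split_ifs <;> (simp_all; try omega)

/-- on a fully charged axis cell the parity weight is `Σ_f phaseK(Z_f)` mod 2 — the mod-2 reduction of the G-orbit key's phase class
`Σ_f phaseK (mod 4)` (`GKeyRel`), which `S₄` and `Δ` preserve; a diagonal cell has phase class `4k ≡ 0`. -/
theorem pwt_pat_mod_two (Z : MCell) (hZ : AxisCell Z) :
    pwt Z.pat % 2 = ((phaseK (Z 0)).val + (phaseK (Z 1)).val + (phaseK (Z 2)).val + (phaseK (Z 3)).val) % 2 := by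
  simp only [pwt, bitOf_pat, kbit_eq_phaseK_mod_two _ (hZ 0), kbit_eq_phaseK_mod_two _ (hZ 1), kbit_eq_phaseK_mod_two _ (hZ 2),
    kbit_eq_phaseK_mod_two _ (hZ 3)]
  omega

/-! ## §2 LEMMA A′ — the chiral seed, all heights (TYPED STATEMENTS, hypothesis form) -/

/-- a DIAGONAL UNIT cell: all four letters the same unit letter `t·I + ℓ_u` (node level `t`, phase `u`). Boost- and inclusion-stable
(◇_h ⊆ ◇_{h+2}), unlike «ceiling unit of height `h`» — the ◇₈ survivor support lies in ◇₁₀ with its FC cell `[6I+ℓ_u]⁴` INTERIOR there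
(point made by the sibling crux idea `b1odd-span-control`, adopted). -/
abbrev IsDiagUnit (Z : MCell) : Prop := ∃ t : ℤ, ∃ u : Fin 4, ∀ f, Z f = ray (t, 0, 0) u 1

/-- a diagonal unit cell is diagonal. -/
theorem isDiag_of_isDiagUnit {Z : MCell} (hZ : IsDiagUnit Z) : IsDiag Z := by
  obtain ⟨t, u, hu⟩ := hZ
  intro f
  rw [hu f, hu 0]

/-- **`NoLowerFC h`** — «`H₁ ∧ G₁ ∧ ◇_h` ⇒ NO fully charged class at level `N`» (◇₈: every N-level FC orbit literal is a failed literal of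
the third code's orbit-CNF, kit j309861, rounds ≤ 13 — machine ×1; ◇₆: j309729; ◇₁₀: open). TYPED STATEMENT, not asserted. -/
def NoLowerFC (h : ℤ) : Prop :=
  ∀ C : MConfig, C.InDiamond h → C.G1Closed → C.StaticH1 → ∀ Z ∈ C.lower, ¬ FCc Z

/-- **`ChiralSeed h`** — LEMMA A′ at height `h` (the CHIRAL, ISOTROPIC seed): on a `G₁`-closed `H₁`-static two-level support in ◇_h there is
NO fully charged N-class, and every fully charged P-class is a diagonal unit cell `[tI+ℓ_u]⁴` (◇₈: `t = 6` only — j309715 rows «≥ 2 distinct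
letters» ∕ «diagonal off the unit letters» UNSAT + j309861 peel, machine ×1; encoder ×2 = bc5-plan j310554 pending; ◇₆: vacuous, j309729).
Antitone in `h` (`chiralSeed_anti`). TYPED STATEMENT, not asserted. -/
def ChiralSeed (h : ℤ) : Prop :=
  ∀ C : MConfig, C.InDiamond h → C.G1Closed → C.StaticH1 →
    (∀ Z ∈ C.lower, ¬ FCc Z) ∧ ∀ P ∈ C.upper, FCc P → IsDiagUnit P

/-- **LEMMA A′ (all even heights).** TYPED STATEMENT, not asserted; ◇₁₀ (bc5-plan kit j308425 and any ◇₁₀ `H₁`-peel) is its first open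
instance. -/
def ChiralSeedAllHeights : Prop := ∀ h : ℤ, h % 2 = 0 → ChiralSeed h

/-- the chiral seed contains the N-level statement. -/
theorem noLowerFC_of_chiralSeed {h : ℤ} (hc : ChiralSeed h) : NoLowerFC h :=
  fun C hU hG hS => (hc C hU hG hS).1

/-- diamonds are nested. -/
theorem inDiamond_mono {h h' : ℤ} (hle : h ≤ h') {C : MConfig} (hC : C.InDiamond h) : C.InDiamond h' :=
  ⟨fun Z hZ f => let ⟨h1, h2, h3, h4⟩ := hC.1 Z hZ f; ⟨h1, h2, h3, le_trans h4 hle⟩,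
   fun P hP f => let ⟨h1, h2, h3, h4⟩ := hC.2 P hP f; ⟨h1, h2, h3, le_trans h4 hle⟩⟩

/-- hence the N-level statement is ANTITONE in the height: `NoLowerFC h'` for one height gives it for every smaller one («for every h» =
its large-`h` tail). -/
theorem noLowerFC_anti {h h' : ℤ} (hle : h ≤ h') (hN : NoLowerFC h') : NoLowerFC h :=
  fun C hU hG hS => hN C (inDiamond_mono hle hU) hG hS

/-- and so is the chiral seed (its conclusion does not read `h`). -/
theorem chiralSeed_anti {h h' : ℤ} (hle : h ≤ h') (hc : ChiralSeed h') : ChiralSeed h :=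
  fun C hU hG hS => hc C (inDiamond_mono hle hU) hG hS

/-- **(T) from LEMMA A′ at ◇₈**: no odd-weight FC class (`Pad4TowerSeedB1Odd.SeedB1OddDiamond8G1H1`). -/
theorem seedB1Odd_of_chiralSeed (h8 : ChiralSeed 8) : SeedB1OddDiamond8G1H1 := by
  intro C hU hG hS hodd
  obtain ⟨hN, hP⟩ := h8 C hU hG hS
  rcases hodd with ⟨Z, hZ, hfc, -⟩ | ⟨P, hPu, hfc, hp⟩
  · exact hN Z hZ hfc
  · exact (not_oddPat_of_isDiag (isDiag_of_isDiagUnit (hP P hPu hfc))).1 hp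

/-- **(S) from LEMMA A′ at ◇₈**: the FC-CORE block fails (`Pad4TowerSeedB1.SeedB1Diamond8G1H1`) — both halves need a non-diagonal pattern
(`0011` resp. `0001`). -/
theorem seedB1_of_chiralSeed (h8 : ChiralSeed 8) : SeedB1Diamond8G1H1 := by
  intro C hU hG hS hb
  obtain ⟨hN, hP⟩ := h8 C hU hG hS
  have key : ∀ κ s, (κ = 3 ∨ κ = 1) → ¬ C.HasSignedFC κ s := by
    intro κ s hκ hks
    unfold MConfig.HasSignedFC at hks
    rcases hks with ⟨Z, hZ, hfc, -, -⟩ | ⟨P, hPu, hfc, hp, -⟩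
    · exact hN Z hZ hfc
    · have hd := not_oddPat_of_isDiag (isDiag_of_isDiagUnit (hP P hPu hfc))
      rcases hκ with rfl | rfl
      · exact hd.2.1 hp
      · exact hd.2.2 hp
  rcases hb with ⟨s, -, he⟩ | ⟨t, -, ho⟩
  · exact key 3 (-s) (Or.inl rfl) he.2.2.1
  · exact key 1 t (Or.inr rfl) ho.1

/-! ## §3 The ι_h-MIRROR of `H₁` and the proved level-duality reduction -/

/-- **the MIRROR bundle** `ι_h H₁ ι_h`: RULE-D closure (self-dual) with `X⁺` and `A2I⁻` of the `h`-DUAL support — i.e. the ι_h-conjugate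
families (b-legs: partners along the ANTIPODAL null direction), NOT the `XMinusClosed`∕`A2IPlusClosed` of record (ι₀-conjugates, a-legs). -/
abbrev StaticH1Mirror (h : ℤ) (C : MConfig) : Prop :=
  RuleDMu4Closed C ∧ XPlusClosed (C.dual h) ∧ A2IMinusClosed (C.dual h)

/-- the down-SHIFT of a letter by `h` (`α ↦ α − h`, `β` fixed). -/
abbrev shiftDown (h : ℤ) (x : BPoint) : BPoint := (x.1 - h, x.2)

/-- `ι₀ ∘ ι_h` is the down-shift: the mirror's `X`-member `XPlusClosed (C.dual h) = XresXClosed ((C.dual h).dual 0)` is the `X⁻`-PREDICATE read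
on the support shifted down by `h` (all `α ≤ 0`), and its `A2I`-member `A2IMinusClosed (C.dual h)` reads `XresA2IClosed` on letters with
`α ≥ 0` — the GUARDED, node-ward branch of `EncDir` — applied to the reflected support: b-legs. Neither is a family of record. -/
theorem dualPt_zero_dualPt (h : ℤ) (x : BPoint) : dualPt 0 (dualPt h x) = shiftDown h x := by
  obtain ⟨a, b1, b2⟩ := x
  simp [dualPt, shiftDown]

/-- the dual support is `H₁`-static iff the support is mirror-static. [`ruleDMu4Closed_dual`] -/
theorem staticH1_dual_iff (h : ℤ) (C : MConfig) : (C.dual h).StaticH1 ↔ StaticH1Mirror h C := by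
  simp only [MConfig.StaticH1, StaticH1Mirror, ruleDMu4Closed_dual]

/-- the `h`-dual of a ◇_h letter is a ◇_h letter (`h` even: floor ↔ ceiling). -/
theorem inDiamond_dualPt {h : ℤ} (hh : h % 2 = 0) {x : BPoint} (hx : InDiamond h x) : InDiamond h (dualPt h x) := by
  obtain ⟨a, b1, b2⟩ := x
  have hc : absCharge (dualPt h (a, b1, b2)) = absCharge (a, b1, b2) := by
    simp only [absCharge, chargeOf]
    rw [show -b1 - -b2 = -(b1 - b2) by ring, abs_neg]
  unfold InDiamond at hx ⊢
  simp only [dualPt] at hx hc ⊢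
  rw [hc]
  generalize absCharge (a, b1, b2) = c at hx ⊢
  obtain ⟨h1, h2, h3, h4⟩ := hx
  refine ⟨?_, by omega, by omega, by omega⟩
  rcases h1 with h0 | hax
  · left; simp_all
  · right; simpa [AxisPt] using hax

/-- ◇_h supports dualise to ◇_h supports. -/
theorem inDiamond_dual {h : ℤ} (hh : h % 2 = 0) {C : MConfig} (hC : C.InDiamond h) : (C.dual h).InDiamond h := by
  refine ⟨fun Z hZ f => ?_, fun P hP f => ?_⟩
  · have := hC.2 _ (mem_dual_lower.1 hZ) f
    simpa [dualCell, dualPt_dualPt] using inDiamond_dualPt hh this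
  · have := hC.1 _ (mem_dual_upper.1 hP) f
    simpa [dualCell, dualPt_dualPt] using inDiamond_dualPt hh this

/-- `Δ` commutes with the dual. -/
theorem dualCell_delta (h : ℤ) (Z : MCell) : dualCell h Z.delta = (dualCell h Z).delta := by
  funext f
  simp [dualCell, dualPt, MCell.delta, deltaPt]

/-- `G₁`-closed supports dualise to `G₁`-closed supports. -/
theorem g1Closed_dual (h : ℤ) {C : MConfig} (hG : C.G1Closed) : (C.dual h).G1Closed := by
  obtain ⟨hpl, hpu, hdl, hdu⟩ := hG
  refine ⟨fun σ Z hZ => ?_, fun σ P hP => ?_, fun Z hZ => ?_, fun P hP => ?_⟩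
  · exact mem_dual_lower.2 (hpu σ _ (mem_dual_lower.1 hZ))
  · exact mem_dual_upper.2 (hpl σ _ (mem_dual_upper.1 hP))
  · rw [mem_dual_lower, dualCell_delta]; exact hdu _ (mem_dual_lower.1 hZ)
  · rw [mem_dual_upper, dualCell_delta]; exact hdl _ (mem_dual_upper.1 hP)

/-- full charge is self-dual. -/
theorem fcc_dualCell {h : ℤ} {Z : MCell} : FCc (dualCell h Z) ↔ FCc Z := by
  simp [FCc, Prod.ext_iff]

/-- **THE LEVEL-DUALITY REDUCTION (proved).** If `H₁ ∧ G₁ ∧ ◇_h` excludes every fully charged N-class, then the MIRROR bundle with `G₁ ∧ ◇_h`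
excludes every fully charged P-class — in particular the census survivor `P[(h−2)I+ℓ_u]⁴` (whose `h`-dual is the floor unit `N[ℓ_{−u}]⁴`,
dead at ◇₈ in round 11 by A2I⁻). -/
theorem noUpperFC_of_noLowerFC {h : ℤ} (hh : h % 2 = 0) (hN : NoLowerFC h) (C : MConfig) (hU : C.InDiamond h) (hG : C.G1Closed)
    (hS : StaticH1Mirror h C) : ∀ P ∈ C.upper, ¬ FCc P := fun P hP hfc =>
  hN (C.dual h) (inDiamond_dual hh hU) (g1Closed_dual h hG) ((staticH1_dual_iff h C).2 hS) (dualCell h P)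
    (dualCell_mem_dual_lower hP) (fcc_dualCell.2 hfc)

/-- conversely (the dual is an involution): the two statements are ONE statement read upside down. -/
theorem noLowerFC_iff_noUpperFCMirror {h : ℤ} (hh : h % 2 = 0) :
    NoLowerFC h ↔ ∀ C : MConfig, C.InDiamond h → C.G1Closed → StaticH1Mirror h C → ∀ P ∈ C.upper, ¬ FCc P := by
  refine ⟨fun hN C hU hG hS => noUpperFC_of_noLowerFC hh hN C hU hG hS, fun hP C hU hG hS Z hZ hfc => ?_⟩
  have hS' : StaticH1Mirror h (C.dual h) := by
    rw [← staticH1_dual_iff, dual_dual]; exact hS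
  exact hP (C.dual h) (inDiamond_dual hh hU) (g1Closed_dual h hG) hS' (dualCell h Z) (dualCell_mem_dual_upper hZ) (fcc_dualCell.2 hfc)

/-- **FC-FREENESS under `H₁` and its mirror (proved from `NoLowerFC h`).** Parity-free, sign-free: no fully charged class at either level. -/
theorem fcFree_of_noLowerFC {h : ℤ} (hh : h % 2 = 0) (hN : NoLowerFC h) (C : MConfig) (hU : C.InDiamond h) (hG : C.G1Closed)
    (hS : C.StaticH1) (hS' : StaticH1Mirror h C) : (∀ Z ∈ C.lower, ¬ FCc Z) ∧ ∀ P ∈ C.upper, ¬ FCc P :=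
  ⟨hN C hU hG hS, noUpperFC_of_noLowerFC hh hN C hU hG hS'⟩

/-- **COROLLARY FOR STUB R's static window (proved from `NoLowerFC h`).** On a `G₁`-closed support in ◇_h static for `H₁` AND its mirror, every
POSITIVE integer multiplicity vector passing the class screen (A1) has `μ = wch(eeee) = 0`: FC-free ⇒ no FC-CORE block
(`fcCoreBlock_of_classScreen`). At `h = 8` the hypothesis is the third code's peel (j309861); the mirror's soundness for (E1) is the pencil
question this line hands to the cell (LEMMA A∪2I for b-legs). -/
theorem wch_eWord_eq_zero_of_noLowerFC {h : ℤ} (hh : h % 2 = 0) (hN : NoLowerFC h) (C : MConfig) (hU : C.InDiamond h)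
    (hG : C.G1Closed) (hS : C.StaticH1) (hS' : StaticH1Mirror h C) (mN mP : MCell → ℤ) (hmN : ∀ Z ∈ C.lower, 0 < mN Z)
    (hmP : ∀ P ∈ C.upper, 0 < mP P) (hA : ClassScreen (C.wch mN mP)) : C.wch mN mP eWord = 0 := by
  by_contra hμ
  obtain ⟨hNa, hPa⟩ := MConfig.axisCell_of_inDiamond hU
  obtain ⟨hN0, hP0⟩ := fcFree_of_noLowerFC hh hN C hU hG hS hS'
  have key : ∀ κ s, ¬ C.HasSignedFC κ s := by
    intro κ s hks
    unfold MConfig.HasSignedFC at hks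
    rcases hks with ⟨Z, hZ, hfc, -, -⟩ | ⟨P, hPu, hfc, -, -⟩
    · exact hN0 Z hZ hfc
    · exact hP0 P hPu hfc
  rcases C.fcCoreBlock_of_classScreen mN mP hNa hPa hmN hmP hA hμ with ⟨s, -, he⟩ | ⟨t, -, ho⟩
  · exact key 0 s he.1
  · exact key 1 t ho.1

/-! ## §4 Probes (`decide`): the survivor and its dual -/

/-- the ◇₈ census survivor `P[6I+ℓ₁]⁴` (third code spelling `P[6I+l-1|…]`, phase index `k = 0`) and its `8`-dual, the floor unit `N[ℓ₋₁]⁴`. -/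
def survivor8 : MCell := mcellOf (ray (6, 0, 0) 0 1) (ray (6, 0, 0) 0 1) (ray (6, 0, 0) 0 1) (ray (6, 0, 0) 0 1)

/-- the survivor is a diagonal unit FC cell of ◇₈ (node level `6` = the ceiling line) with pattern `0000`, fixed by every factor swap generator, and its `8`-dual is the
floor unit diagonal `[ℓ₂]⁴ = [ℓ₋₁]⁴` (`lpt 1 2`). [kernel, `decide`] -/
theorem survivor8_probe : IsDiagUnit survivor8 ∧ FCc survivor8 ∧ MCell.InDiamond 8 survivor8 ∧ survivor8.pat = 0 ∧
    survivor8.perm (Equiv.swap 0 1) = survivor8 ∧ survivor8.perm (Equiv.swap 1 2) = survivor8 ∧ survivor8.perm (Equiv.swap 2 3) = survivor8 ∧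
    dualCell 8 survivor8 = mcellOf (lpt 1 2) (lpt 1 2) (lpt 1 2) (lpt 1 2) := by
  refine ⟨⟨6, 0, fun f => by fin_cases f <;> rfl⟩, ?_, ?_, ?_, ?_, ?_, ?_, ?_⟩ <;> decide +kernel

/-- the mixed ceiling unit cell `P[6I+ℓ₁|6I+ℓ₁|6I+ℓ_i|6I+ℓ₁]` of the W1 no-Ψ witnesses (OBS-CEILING-UNIT-CELL §1; third-code phase index of `i`
is `k = 3`). -/
def mixedCeiling8 : MCell := mcellOf (ray (6, 0, 0) 0 1) (ray (6, 0, 0) 0 1) (ray (6, 0, 0) 3 1) (ray (6, 0, 0) 0 1)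

/-- it is NOT diagonal, has ODD weight, is an FC cell of ◇₈, and is moved by the factor swap `(2 3)`: non-isotropic ⇒ outside LEMMA A′'s
survivor stratum (census: every such class dies under `H₁ ∧ G₁`, j309715 row «FC with ≥ 2 distinct letters» UNSAT). [kernel, `decide`] -/
theorem mixedCeiling8_probe : ¬ IsDiag mixedCeiling8 ∧ OddPat mixedCeiling8.pat ∧ FCc mixedCeiling8 ∧ MCell.InDiamond 8 mixedCeiling8 ∧
    mixedCeiling8.perm (Equiv.swap 2 3) ≠ mixedCeiling8 := by
  decide +kernel

/-! ## §4c Probe (`decide`): the GUARD CHIRALITY of the `A2I` family at the survivor letter -/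

/-- At the survivor letter `6I+ℓ₁ = (7,1,0)`: the encoder direction is `u = 0`; in the `0`-dual world (the `A2I⁺` OF RECORD) it is again
`u = 0` and the depth-1 partner letter pulls back to `6I+2ℓ₁ = (8,2,0)`, UP the own ray and OUTSIDE ◇₈ — so `A2I⁺` has no instance at the
survivor; in the `8`-dual world (the MIRROR `A2IMinusClosed (C.dual 8)`) the direction is the antipodal `u = 2`, the depth-1 partner obeys the
guard (`d = 1 ≤ cabs = 1`) and pulls back to the top node `8I = (8,0,0)` ∈ ◇₈ — the survivor's LIFT `Z(σ ↦ 8I)`, present on every static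
support by RULE-D (LEMMA U-ceiling, g53). The two conjugations of `A2I⁻` are different families. [kernel, `decide`] -/
theorem guardChirality_probe_orig : EncDir (7, 1, 0) 0 ∧ ∀ u : Fin 4, EncDir (7, 1, 0) u → u = 0 := by
  decide +kernel

/-- `A2I⁺` of record at the survivor letter: `EncDir` picks the FLIPPED direction `u = 0` (not the letter's own `β`-direction `2` in the
negated world), and the depth-1 partner pulls back to `6I+2ℓ₁ = (8,2,0) ∉ ◇₈` (a-leg UP); the UNflipped direction `2` — what the conjugation
principle ι₀∘(N↔P) applied to `A2I⁻` prescribes — would pull back to the lift `8I = (8,0,0)` (b-leg up), exactly as the `8`-mirror below. -/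
theorem guardChirality_probe_dual0 : (∀ u : Fin 4, EncDir (dualPt 0 (7, 1, 0)) u → u = 0) ∧ ¬ EncDir (dualPt 0 (7, 1, 0)) 2 ∧
    dualPt 0 (ray (dualPt 0 (7, 1, 0)) 0 (-1)) = ((8 : ℤ), (2 : ℤ), (0 : ℤ)) ∧ ¬ InDiamond 8 ((8 : ℤ), (2 : ℤ), (0 : ℤ)) ∧
    dualPt 0 (ray (dualPt 0 (7, 1, 0)) 2 (-1)) = ((8 : ℤ), (0 : ℤ), (0 : ℤ)) := by
  decide +kernel

/-- the `8`-MIRROR of `A2I⁻` at the survivor letter: antipodal direction `u = 2`, guard `cabs = 1`, depth-1 partner pulls back to `8I ∈ ◇₈`. -/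
theorem guardChirality_probe_dual8 : (∀ u : Fin 4, EncDir (dualPt 8 (7, 1, 0)) u → u = 2) ∧ EncDir (dualPt 8 (7, 1, 0)) 2 ∧
    cabs (dualPt 8 (7, 1, 0)) = 1 ∧ dualPt 8 (ray (dualPt 8 (7, 1, 0)) 2 (-1)) = ((8 : ℤ), (0 : ℤ), (0 : ℤ)) ∧
    InDiamond 8 ((8 : ℤ), (0 : ℤ), (0 : ℤ)) := by
  decide +kernel

end AnomalyLens

end Summit.Ventures.HSemireg.Pad4Tower
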